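import Literature.MathematicalPhysics.QuantumFieldTheory.Balaban1983to89.T4CouplingMatching

/-!
# NE7PairwiseCouplingStep — row NE7 (node U5), route «PAIR-CAUCHY»: the coupling-matching recursion of
# `T4CouplingMatching` §3 for a pair of runs with an ARBITRARY offset `n = K′ − K` (run A of `K` steps against run B
# of `K + n` steps), the AF weight sum with offset, and the printed-type BOX ∕ AFFINE a-priori bounds — the one-step
# bookkeeping that docks the marginal lemma (M♭′) `NE7PairwiseMarginalBox` to the β-road BY NAME

Cell `pub-balaban`, rung (B)+1 sub-cell t4, lineage `b2b-balaban-t4-ne7-p2` (CRUX PROVER NE7 #2 under the coordinator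
ruling «YM redirect», 2026-08-21; generation 49; route text `HOME/t4/b2b-balaban-t4-ne7-p2/g48/ROUTE2-NE7-P2.md` v1.3.1
§2 (M♭)∕(M♭′) and §5 step 0 «dock (M♭) to the β-road BY NAME»).  HONEST FRAMING (page 1): FIXED FINITE T⁴, rung (B)+1 =
existence AND uniqueness of the `ε = L^{−K} → 0` limit of unit-scale averaged expectations, CONDITIONAL on BetaPertH and
the nine spine estimates (0/9 proved); NOT infinite volume, NOT a mass gap, NOT the Clay problem.  NE7 is NOT PRINTED in
[Balaban1984PropagatorsI]–[Balaban1989LargeFieldII] and NOT proved here.  Everything below is [folklore] real analysis over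
the tree's vocabulary `FlowStep.RGEqH ∕ prefixOf ∕ Box ∕ BetaUpperH` and `T4CouplingMatching.HistLipschitz ∕
EventualLowerH` (hypothesis SHAPES, never facts); no definition, no cite tag, nothing printed asserted, no `sorry`.

WHY.  `T4CouplingMatching.disc_step` compares run A (`K` steps from `ε = L^{−K}`) with run B (`K + 1` steps) — offset
`n = 1`, the CONSECUTIVE organisation of node U5 (`MatchingModConstants` + `Summable δ`).  The route «PAIR-CAUCHY»
(`Support/NE7PairwiseCauchy`: node U6 ∕ U0 from a PAIRWISE comparison with a remainder that only tends to zero) compares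
run `K` with ANY finer run `K′ = K + n` directly, so its marginal channel needs the same recursion with an arbitrary
offset: run A's scale `j` is infrared-matched with run B's scale `j + n`, the matched sub-history of B's prefix
`(g^B_0, …, g^B_{j+n})` is `(g^B_n, …, g^B_{j+n})` = `prefixOf (fun i => g^B (i + n)) j` (drop the `n` ultraviolet-most
couplings, which have no partner), and (0.20) for both runs gives, for `j < K`,
  `|x^A_j − x^B_{j+n}| ≤ |x^A_{j+1} − x^B_{j+1+n}|`
      `+ |β_{j+n}(g^B_0,…,g^B_{j+n}) − β_j(g^B_n,…,g^B_{j+n})|`      [the n-LAYER SCALE SHIFT at B's own couplings]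
      `+ Σ_{i≤j} Λ j i · |g^A_i − g^B_{i+n}|`                        [the HISTORY SHIFT at scale j, `HistLipschitz`]
(`x = 1∕g²`; §1 `discOff_step`), hence by backward accumulation from the infrared pin `g^A_K = g^B_{K+n}` (§1
`discOff_backward`) a bound by the sum over the scales `l ∈ [j, K)`.  The coupling gap `|g^A_i − g^B_{i+n}|` is kept
UN-converted, because (M♭′) consumes it twice: through the printed BOX (`≤ γ`, both runs in `]0, γ]` — [Balaban1987RG1]
Thm 1 p. 259; §3 `abs_sub_le_of_box`) and through the `x → g` conversion (`≤ (g^A_i)²g^B_{i+n}·|x^A_i − x^B_{i+n}|`,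
tree `T4CouplingMatching.abs_sub_le_of_inv_sq`).  §2 is the AF weight sum `Σ_{i≤K} (g^A_i)² g^B_{i+n} ≤ (k₀+1)γ³ + 2γ∕b`
with offset (verbatim twin of `T4CouplingMatching.sum_weights_le_of_eventualLower`, which is the case `n = 1`; the
bound is `n`-free because both runs sit `K − i` steps above their common pinned end), and §3 the scale-wise AFFINE a-priori
bound `|x^A_j − x^B_{j+n}| ≤ 1∕(g^A_K)² + β′·(K − j)` from the printed-type upper bound `BetaUpperH β′` (telescoped (0.20)
upwards from the pin, `FlowStep.inv_sq_telescopeH`) and the box (`1∕γ² ≤ x`).  The companion `NE7PairwiseCouplingDock`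
re-indexes to block scales `m = K − j` counted from the unit lattice and feeds `NE7PairwiseMarginalBox.marginalBox_tendsto_zero`.

WHAT IS PROVED ([folklore]).
§1 `prefixOf_shift_mem_box`, **`discOff_step`** (the displayed recursion), **`discOff_backward`**
   (`|x^A_j − x^B_{j+n}| ≤ Σ_{l∈[j,K)} (SS l + Σ_{i≤l} Λ l i |g^A_i − g^B_{i+n}|)` for `j ≤ K` under the pin).
§2 **`sum_weightsOff_le_of_eventualLower`** (`Σ_{i≤K} (g^A_i)² g^B_{i+n} ≤ (k₀+1)γ³ + 2γ∕b` from `EventualLowerH b γ k₀ β`).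
§3 `abs_sub_le_of_box`, `inv_sq_bounds_of_run` (`1∕γ² ≤ x_j ≤ x_K + β′(K − j)` along one run), **`discOff_le_affine`**.

NOT DELIVERED here: the null property of the n-layer scale shift (THE ask of the route in the marginal channel, consumed as
a hypothesis by the companion), any fact about [Balaban1987RG1]'s β-functions.  NOT NE7 (spine 0/9 unchanged), NOT summit
progress.  HONEST DEPENDENCY: continuum YM on T⁴ ⇐ BetaPertH ∧ nine spine estimates (0/9 proved); BetaPertH ⇐ (D1) ∧ (D4)
∧ CAP+tail; G-an2-4 gates asym, D1 and NE2/3/4.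
-/

noncomputable section

open Finset
open scoped BigOperators

namespace Summit.QuantumFields.BalabanUV.T4Continuum.NE7PairwiseCouplingStep

open Literature.MathematicalPhysics.QuantumFieldTheory.Balaban1983to89
open Literature.MathematicalPhysics.QuantumFieldTheory.Balaban1983to89.FlowStep
open Literature.MathematicalPhysics.QuantumFieldTheory.Balaban1983to89.T4CouplingMatching

/-! ## §1 The offset-`n` coupling-matching recursion and its backward accumulation -/

/-- The matched sub-history of the finer run lies in the box: if the couplings `g_0, …, g_N` lie in `]0, γ]` and
`k + n ≤ N`, then `prefixOf (fun i => g (i + n)) k = (g_n, …, g_{k+n}) ∈ Box γ k`. [folklore] -/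
theorem prefixOf_shift_mem_box {γ : ℝ} {g : ℕ → ℝ} {N n k : ℕ} (hk : k + n ≤ N)
    (hg : ∀ i, i ≤ N → 0 < g i ∧ g i ≤ γ) : prefixOf (fun i => g (i + n)) k ∈ Box γ k :=
  prefixOf_mem_box (N := N - n) (by omega) fun i hi => hg (i + n) (by omega)

/-- **THE OFFSET-`n` COUPLING-MATCHING RECURSION** (offset-`n` twin of `T4CouplingMatching.disc_step`, which is `n = 1`
with the scale-shift term bounded by `ScaleShiftRate`).  Run A: `RGEqH K β gA`; run B: `RGEqH (K + n) β gB`; couplings in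
`]0, γ]`; history moduli `HistLipschitz Λ γ β`.  For `j < K`:
`|1∕(g^A_j)² − 1∕(g^B_{j+n})²| ≤ |1∕(g^A_{j+1})² − 1∕(g^B_{j+1+n})²|`
  `+ |β (j+n) (g^B_0,…,g^B_{j+n}) − β j (g^B_n,…,g^B_{j+n})| + Σ_{i≤j} Λ j i · |g^A_i − g^B_{i+n}|`
— subtract (0.20) of run A at step `j` from (0.20) of run B at step `j + n`; the β-difference splits into the n-layer
SCALE SHIFT at B's own couplings (kept verbatim) and the HISTORY SHIFT at scale `j`.  Hypothesis shapes, never facts.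
[folklore] -/
theorem discOff_step {β : HBeta} {γ : ℝ} {Λ : ℕ → ℕ → ℝ} {K n : ℕ} {gA gB : ℕ → ℝ}
    (hA : RGEqH K β gA) (hB : RGEqH (K + n) β gB)
    (hAbox : ∀ i, i ≤ K → 0 < gA i ∧ gA i ≤ γ) (hBbox : ∀ i, i ≤ K + n → 0 < gB i ∧ gB i ≤ γ)
    (hL : HistLipschitz Λ γ β) {j : ℕ} (hj : j < K) :
    |1 / (gA j) ^ 2 - 1 / (gB (j + n)) ^ 2|
      ≤ |1 / (gA (j + 1)) ^ 2 - 1 / (gB (j + 1 + n)) ^ 2|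
        + |β (j + n) (prefixOf gB (j + n)) - β j (prefixOf (fun i => gB (i + n)) j)|
        + ∑ i ∈ range (j + 1), Λ j i * |gA i - gB (i + n)| := by
  have eA := hA j hj
  have eB := hB (j + n) (by omega)
  have hpA : prefixOf gA j ∈ Box γ j := prefixOf_mem_box hj.le hAbox
  have hpB : prefixOf (fun i => gB (i + n)) j ∈ Box γ j :=
    prefixOf_shift_mem_box (N := K + n) (by omega) hBbox
  have h2 := hL j (prefixOf (fun i => gB (i + n)) j) (prefixOf gA j) hpB hpA
  have h3 : ∑ i : Fin (j + 1), Λ j i * |prefixOf (fun i => gB (i + n)) j i - prefixOf gA j i|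
      = ∑ i ∈ range (j + 1), Λ j i * |gA i - gB (i + n)| := by
    rw [Finset.sum_range (fun i => Λ j i * |gA i - gB (i + n)|)]
    refine Finset.sum_congr rfl fun i _ => ?_
    simp only [prefixOf_apply]
    rw [abs_sub_comm]
  rw [h3] at h2
  have e1 : j + n + 1 = j + 1 + n := by omega
  have key : 1 / gA j ^ 2 - 1 / gB (j + n) ^ 2
      = (1 / gA (j + 1) ^ 2 - 1 / gB (j + 1 + n) ^ 2)
        + (β j (prefixOf gA j) - β j (prefixOf (fun i => gB (i + n)) j))
        - (β (j + n) (prefixOf gB (j + n)) - β j (prefixOf (fun i => gB (i + n)) j)) := by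
    rw [eA, eB, e1]; ring
  have habs : |1 / gA j ^ 2 - 1 / gB (j + n) ^ 2|
      ≤ |1 / gA (j + 1) ^ 2 - 1 / gB (j + 1 + n) ^ 2|
        + |β j (prefixOf gA j) - β j (prefixOf (fun i => gB (i + n)) j)|
        + |β (j + n) (prefixOf gB (j + n)) - β j (prefixOf (fun i => gB (i + n)) j)| := by
    rw [key]
    exact (abs_sub _ _).trans (add_le_add (abs_add_le _ _) le_rfl)
  have hcomm : |β j (prefixOf gA j) - β j (prefixOf (fun i => gB (i + n)) j)|
      = |β j (prefixOf (fun i => gB (i + n)) j) - β j (prefixOf gA j)| := abs_sub_comm _ _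
  linarith [habs, hcomm, h2]

/-- **BACKWARD ACCUMULATION FROM THE INFRARED PIN** (offset-`n` twin of the first half of
`T4CouplingMatching.disc_le_of_lastOnly`'s bookkeeping).  Under the pin `g^A_K = g^B_{K+n}` (both runs end at the
renormalised coupling — Theorem 2's `g_K = g` for each run, a hypothesis), `discOff_step` and `backward_sum` give, for
`j ≤ K`: `|1∕(g^A_j)² − 1∕(g^B_{j+n})²| ≤ Σ_{l∈[j,K)} ( |β (l+n) (g^B_{≤ l+n}) − β l (g^B_{n ≤ · ≤ l+n})| + Σ_{i≤l} Λ l i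
· |g^A_i − g^B_{i+n}| )`. [folklore] -/
theorem discOff_backward {β : HBeta} {γ : ℝ} {Λ : ℕ → ℕ → ℝ} {K n : ℕ} {gA gB : ℕ → ℝ}
    (hA : RGEqH K β gA) (hB : RGEqH (K + n) β gB)
    (hAbox : ∀ i, i ≤ K → 0 < gA i ∧ gA i ≤ γ) (hBbox : ∀ i, i ≤ K + n → 0 < gB i ∧ gB i ≤ γ)
    (hpin : gA K = gB (K + n)) (hL : HistLipschitz Λ γ β) {j : ℕ} (hj : j ≤ K) :
    |1 / (gA j) ^ 2 - 1 / (gB (j + n)) ^ 2|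
      ≤ ∑ l ∈ Ico j K, (|β (l + n) (prefixOf gB (l + n)) - β l (prefixOf (fun i => gB (i + n)) l)|
          + ∑ i ∈ range (l + 1), Λ l i * |gA i - gB (i + n)|) := by
  refine backward_sum (δ := fun j => |1 / (gA j) ^ 2 - 1 / (gB (j + n)) ^ 2|)
    (s := fun l => |β (l + n) (prefixOf gB (l + n)) - β l (prefixOf (fun i => gB (i + n)) l)|
      + ∑ i ∈ range (l + 1), Λ l i * |gA i - gB (i + n)|) ?_ ?_ j hj
  · rw [hpin, sub_self, abs_zero]
  · intro l hl
    have h := discOff_step hA hB hAbox hBbox hL hl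
    linarith

/-! ## §2 The asymptotic-freedom weight sum with offset `n` -/

/-- **THE AF WEIGHT SUM IS K- AND n-UNIFORM** (offset-`n` twin of `T4CouplingMatching.sum_weights_le_of_eventualLower`,
the case `n = 1`): along run A (`K` steps) and run B (`K + n` steps) of (0.20), couplings in `]0, γ]`, with an EVENTUAL
trajectory-wise lower bound `b ≤ β_{m+1}` on the boxes for `m ≥ k₀` (`EventualLowerH b γ k₀ β`, `b > 0` — UNPRINTED
input, the `Beta.Assembly.LimitForm.tail_lower` shape), `Σ_{i≤K} (g^A_i)² g^B_{i+n} ≤ (k₀ + 1)γ³ + 2γ∕b`: both `g^A_i` and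
`g^B_{i+n}` sit `K − i` steps above their run's end, so `T4CouplingMatching.inv_sq_lower_of_eventualLower` bounds both by
the same profile `a_{K−i} = 1∕γ² + b(K − i)`, and the reflected profile sum is `T4CouplingMatching.sum_profWeights_le`.
[folklore] -/
theorem sum_weightsOff_le_of_eventualLower {β : HBeta} {γ b : ℝ} {k₀ K n : ℕ} {gA gB : ℕ → ℝ}
    (hγ : 0 < γ) (hb : 0 < b) (hA : RGEqH K β gA) (hB : RGEqH (K + n) β gB)
    (hAbox : ∀ i, i ≤ K → 0 < gA i ∧ gA i ≤ γ) (hBbox : ∀ i, i ≤ K + n → 0 < gB i ∧ gB i ≤ γ)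
    (hlo : EventualLowerH b γ k₀ β) :
    ∑ i ∈ range (K + 1), (gA i) ^ 2 * gB (i + n) ≤ ((k₀ : ℝ) + 1) * γ ^ 3 + 2 * γ / b := by
  have hp0 := sprof_pos hγ hb.le
  -- pointwise on the AF scales `k₀ ≤ i ≤ K`: u_i ≤ f (K - i) with f m = (1/p_m²)(1/p_m), p_m = √(1/γ² + b m)
  have hpt : ∀ i, k₀ ≤ i → i ≤ K →
      (gA i) ^ 2 * gB (i + n) ≤ 1 / (sprof γ b (K - i)) ^ 2 * (1 / sprof γ b (K - i)) := by
    intro i hk hi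
    have hgA := hAbox i hi
    have hgB := hBbox (i + n) (by omega)
    have hgAK := hAbox K le_rfl
    have hgBK := hBbox (K + n) le_rfl
    have hAK : 1 / γ ^ 2 ≤ 1 / (gA K) ^ 2 :=
      one_div_le_one_div_of_le (pow_pos hgAK.1 2) (pow_le_pow_left₀ hgAK.1.le hgAK.2 2)
    have hBK : 1 / γ ^ 2 ≤ 1 / (gB (K + n)) ^ 2 :=
      one_div_le_one_div_of_le (pow_pos hgBK.1 2) (pow_le_pow_left₀ hgBK.1.le hgBK.2 2)
    have h1 := inv_sq_lower_of_eventualLower hA hAbox hlo hk hi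
    have h2 := inv_sq_lower_of_eventualLower hB hBbox hlo (i := i + n) (by omega) (by omega)
    have hKi : ((K + n - (i + n) : ℕ) : ℝ) = ((K - i : ℕ) : ℝ) := by congr 1; omega
    rw [hKi] at h2
    have haA : prof γ b (K - i) ≤ 1 / (gA i) ^ 2 := by unfold prof; linarith
    have haB : prof γ b (K - i) ≤ 1 / (gB (i + n)) ^ 2 := by unfold prof; linarith
    have hsqA : (gA i) ^ 2 ≤ 1 / (sprof γ b (K - i)) ^ 2 := by
      rw [sprof_sq hγ hb.le, le_one_div (pow_pos hgA.1 2) (prof_pos hγ hb.le _)]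
      exact haA
    have hsqB : (gB (i + n)) ^ 2 ≤ (1 / sprof γ b (K - i)) ^ 2 := by
      rw [one_div_pow, sprof_sq hγ hb.le, le_one_div (pow_pos hgB.1 2) (prof_pos hγ hb.le _)]
      exact haB
    have hB' : gB (i + n) ≤ 1 / sprof γ b (K - i) :=
      (pow_le_pow_iff_left₀ hgB.1.le (one_div_pos.mpr (hp0 _)).le two_ne_zero).mp hsqB
    exact mul_le_mul hsqA hB' hgB.1.le (by positivity)
  -- pointwise on all scales: u_i ≤ γ³ by the box alone
  have hcube : ∀ i, i ≤ K → (gA i) ^ 2 * gB (i + n) ≤ γ ^ 3 := by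
    intro i hi
    have hgA := hAbox i hi
    have hgB := hBbox (i + n) (by omega)
    calc (gA i) ^ 2 * gB (i + n) ≤ γ ^ 2 * γ :=
          mul_le_mul (pow_le_pow_left₀ hgA.1.le hgA.2 2) hgB.2 hgB.1.le (sq_nonneg γ)
      _ = γ ^ 3 := by ring
  -- combine: u_i ≤ [i < k₀]·γ³ + f (K - i)
  have hmaj : ∀ i ∈ range (K + 1), (gA i) ^ 2 * gB (i + n)
      ≤ (if i < k₀ then γ ^ 3 else 0) + 1 / (sprof γ b (K - i)) ^ 2 * (1 / sprof γ b (K - i)) := by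
    intro i hi
    have hi' : i ≤ K := Nat.lt_succ_iff.mp (mem_range.mp hi)
    have hf : 0 ≤ 1 / (sprof γ b (K - i)) ^ 2 * (1 / sprof γ b (K - i)) := by
      have := hp0 (K - i); positivity
    by_cases hik : i < k₀
    · rw [if_pos hik]; linarith [hcube i hi']
    · rw [if_neg hik, zero_add]; exact hpt i (not_lt.mp hik) hi'
  have hind : ∑ i ∈ range (K + 1), (if i < k₀ then γ ^ 3 else (0 : ℝ)) ≤ (k₀ : ℝ) * γ ^ 3 := by
    rw [Finset.sum_ite, Finset.sum_const_zero, add_zero, Finset.sum_const, nsmul_eq_mul]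
    have hcard : ((range (K + 1)).filter (fun i => i < k₀)).card ≤ k₀ := by
      calc ((range (K + 1)).filter (fun i => i < k₀)).card ≤ (range k₀).card :=
            Finset.card_le_card fun i hi => mem_range.mpr (Finset.mem_filter.mp hi).2
        _ = k₀ := Finset.card_range k₀
    exact mul_le_mul_of_nonneg_right (by exact_mod_cast hcard) (pow_nonneg hγ.le 3)
  calc ∑ i ∈ range (K + 1), (gA i) ^ 2 * gB (i + n)
      ≤ ∑ i ∈ range (K + 1),
          ((if i < k₀ then γ ^ 3 else 0) + 1 / (sprof γ b (K - i)) ^ 2 * (1 / sprof γ b (K - i))) :=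
        Finset.sum_le_sum hmaj
    _ = (∑ i ∈ range (K + 1), (if i < k₀ then γ ^ 3 else (0 : ℝ)))
          + ∑ i ∈ range (K + 1), 1 / (sprof γ b (K - i)) ^ 2 * (1 / sprof γ b (K - i)) :=
        Finset.sum_add_distrib
    _ ≤ (k₀ : ℝ) * γ ^ 3 + (γ ^ 3 + 2 * γ / b) := add_le_add hind (sum_profWeights_le hγ hb K)
    _ = ((k₀ : ℝ) + 1) * γ ^ 3 + 2 * γ / b := by ring

/-! ## §3 The printed-type BOX bound on the coupling gap and the scale-wise AFFINE a-priori bound -/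

/-- THE BOX: two couplings in `]0, γ]` differ by at most `γ` ([Balaban1987RG1] Thm 1 p. 259 «contained in an interval
]0, γ]», applied to each run; here a hypothesis on two reals). [folklore] -/
theorem abs_sub_le_of_box {a c γ : ℝ} (ha : 0 < a ∧ a ≤ γ) (hc : 0 < c ∧ c ≤ γ) : |a - c| ≤ γ := by
  rw [abs_sub_le_iff]
  constructor <;> linarith [ha.1, ha.2, hc.1, hc.2]

/-- ALONG ONE RUN: `1∕γ² ≤ 1∕g_j² ≤ 1∕g_K² + β′·(K − j)` for `j ≤ K` — the box below, the telescoped (0.20) with the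
printed-type upper bound `BetaUpperH β′ γ β` above (`FlowStep.inv_sq_telescopeH`; the upper half of the discrete (0.31)).
[folklore] -/
theorem inv_sq_bounds_of_run {β : HBeta} {γ β' : ℝ} {K : ℕ} {g : ℕ → ℝ} (hK : RGEqH K β g)
    (hbox : ∀ i, i ≤ K → 0 < g i ∧ g i ≤ γ) (hup : BetaUpperH β' γ β) {j : ℕ} (hj : j ≤ K) :
    1 / γ ^ 2 ≤ 1 / (g j) ^ 2 ∧ 1 / (g j) ^ 2 ≤ 1 / (g K) ^ 2 + β' * ((K - j : ℕ) : ℝ) := by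
  constructor
  · have hg := hbox j hj
    exact one_div_le_one_div_of_le (pow_pos hg.1 2) (pow_le_pow_left₀ hg.1.le hg.2 2)
  · rw [inv_sq_telescopeH hK hj le_rfl]
    have hsum := Finset.sum_le_card_nsmul (Ico j K) (fun m => β m (prefixOf g m)) β'
      (fun m hm => hup m _ (prefixOf_mem_box (Finset.mem_Ico.mp hm).2.le hbox))
    rw [Nat.card_Ico, nsmul_eq_mul] at hsum
    linarith

/-- **THE SCALE-WISE AFFINE A-PRIORI BOUND** on the offset-`n` discrepancy: under the pin `g^A_K = g^B_{K+n}`, the box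
and `BetaUpperH β′ γ β` with `β′ ≥ 0`, `|1∕(g^A_j)² − 1∕(g^B_{j+n})²| ≤ 1∕(g^A_K)² + β′·(K − j)` for `j ≤ K` (both
`x`-values lie in `[1∕γ², 1∕(g^A_K)² + β′(K − j)]` and `1∕γ² > 0`).  This is the hypothesis `hB` of
`NE7PairwiseMarginalBox.marginalBox_tendsto_zero` at block scale `m = K − j`. [folklore] -/
theorem discOff_le_affine {β : HBeta} {γ β' : ℝ} {K n : ℕ} {gA gB : ℕ → ℝ}
    (hA : RGEqH K β gA) (hB : RGEqH (K + n) β gB)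
    (hAbox : ∀ i, i ≤ K → 0 < gA i ∧ gA i ≤ γ) (hBbox : ∀ i, i ≤ K + n → 0 < gB i ∧ gB i ≤ γ)
    (hpin : gA K = gB (K + n)) (hup : BetaUpperH β' γ β) (hβ' : 0 ≤ β') {j : ℕ} (hj : j ≤ K) :
    |1 / (gA j) ^ 2 - 1 / (gB (j + n)) ^ 2| ≤ 1 / (gA K) ^ 2 + β' * ((K - j : ℕ) : ℝ) := by
  obtain ⟨hA1, hA2⟩ := inv_sq_bounds_of_run hA hAbox hup hj
  obtain ⟨hB1, hB2⟩ := inv_sq_bounds_of_run hB hBbox hup (j := j + n) (by omega)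
  have e : ((K + n - (j + n) : ℕ) : ℝ) = ((K - j : ℕ) : ℝ) := by congr 1; omega
  rw [e, ← hpin] at hB2
  have hγ : 0 < γ := lt_of_lt_of_le (hAbox K le_rfl).1 (hAbox K le_rfl).2
  have hγ2 : 0 < 1 / γ ^ 2 := by positivity
  have hm : 0 ≤ β' * ((K - j : ℕ) : ℝ) := mul_nonneg hβ' (Nat.cast_nonneg _)
  rw [abs_sub_le_iff]
  constructor <;> linarith

end Summit.QuantumFields.BalabanUV.T4Continuum.NE7PairwiseCouplingStep

end
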